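import Literature.IUT.HodgeTheaters.PiAvatarEvalSections
import HarnessLib

/-!
# [IUTchI] Ex 4.4 (i) / Prop 6.7 at bad places: the evaluation-section class `φ^Θ_{v̲_j}` consists of NON-invertible outer homomorphisms
# and meets NO morphism of the orbit category (J-Θ-1 in kernel form over abc-iut-L5-t3's outer hom-type; node IUTchI:Prop6.7, law (γ);
# proof-only, no definition, no new `Prop` fact)

S. Mochizuki, *Inter-universal Teichmüller theory I*, kurims manuscript (May 2020), Example 4.4 (i) p. 106 l. 29–31 (the evaluation
sections and their labels `j ∈ |𝔽_l|`), (ii) pp. 106–107 (from p. 106 l. 45; p. 107 l. 2–6: «the various morphisms `ℬ^temp(Π_v̲)⁰ → ℬ^temp(Π_v̲)⁰` that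
arise [i.e., via composition with the natural surjection `Π_v̲ ↠ G_v̲`] from the evaluation sections labeled `j`»; «composing with arbitrary
isomorphisms»), Proposition 6.7 p. 167, §0 «Categories» p. 34 ([IUTchI] Ex 4.4 (i) p.106)
[claim: Mochizuki2012, status: disputed] (D-0012 claim key, series status DISPUTED — kernel theorems about abc-iut's OWN typings; nothing of the
series is asserted and no side is taken on [IUTchIII] Cor. 3.12).

## What this file proves (the positive half of abc-iut-w4-d054's obstruction p456090 `PiAvatarKitCoreObstruction`, over abc-iut-L5-t3's
## `PiAvatarOuterHom` p455871/p456597 + `PiAvatarEvalSections` p456293/p456598)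

`PiAvatarKitCoreObstruction` shows that the ambient of the genuine Π-avatar kits (full subcategory of the orbit category, design D1 EMBEDDED)
cannot host a §4 datum at a bad place with CLOSED local group (`KitCore`/`EvalBinder` uninhabited), the reason being that a §4 datum FORCES a
non-invertible endomorphism of `𝒟_v̲` (`BaseThetaDatum.exists_endo_not_isIso`).  Here, in abc-iut-L5-t3's outer hom-type `OuterHom H H′ =
(H →* H′)/Inn(H′)` — the non-vacuous re-typing (iv-c) of RULINGS #82 — we prove that the printed `φ^Θ_{v̲_j} = [s_j ∘ aug|_{Π_v̲}]` and EVERY member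
of its two-sided `Aut(𝒟_v̲)`-saturated class (`EvalSections.thetaClass j`) is:

* NOT injective-type (no representative is injective: `EvalSections.not_injective_of_ofHom_eq_evalOuter`, `…_of_mem_thetaClass`),
* NOT an outer isomorphism (`EvalSections.not_isOuterIso_evalOuter`, `not_isOuterIso_of_mem_thetaClass`),
* NOT the outer class `OrbitCat.toOuter f` of ANY morphism `f` of the orbit category (`EvalSections.toOuter_ne_evalOuter`,
  `toOuter_ne_of_mem_thetaClass`),

as soon as `Π_v̲` meets the geometric part non-trivially (`hΔ : ∃ x ∈ Π_v̲, aug x = 1, x ≠ 1` — Def 3.1 (e): `Π_v̲ ↠ G_v̲` has kernel `Δ_v̲ ≠ 1`; a named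
hypothesis, not asserted).  Ingredients: `OuterHom.injective_of_ofHom_eq` (injectivity is a CLASS invariant), `OuterHom.injective_of_isOuterIso`,
abc-iut-L5-t3's `OrbitCat.exists_injective_rep_toOuter` and `EvalSections.evalHom_eq_one_of_aug_eq_one`.  So the outer hom-type satisfies the
NECESSARY CONDITION of p456090 (non-invertible endomorphisms exist) by design, and the printed class is disjoint from the coset maps — the
kernel form of junction J-Θ-1 (abc-iut-L5-t3 g6 14:46:47Z; GAP-LEDGER G-w4d054g7-1).  typed ≠ inhabited ≠ discharged; binder ≠ fact.
v2 (doc-only, referee-n N16-F4 LOW): the composite-morphism sentence is Example 4.4 (ii), not (i) — four per-decl locators re-pointed to the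
joint form `Ex 4.4 (i)(ii) p.107` (Prop 6.7 cites «Example 4.4, (i), (ii)» jointly); declarations byte-identical to v1 (p457456).
-/

namespace Literature.IUT.HodgeTheaters

open CategoryTheory

universe u v w

/-! ### Injectivity is an invariant of the outer class -/

namespace OuterHom

variable {A : Type u} [Group A] {H H' : Subgroup A}

/-- Inner-equivalent homomorphisms are injective together: injectivity is a property of the OUTER class. ([IUTchI] §0 p.34) [claim: Mochizuki2012, status: disputed] -/
theorem injective_of_ofHom_eq {φ ψ : H →* H'} (h : ofHom φ = ofHom ψ) (hφ : Function.Injective φ) :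
    Function.Injective ψ := by
  obtain ⟨c, hc⟩ := (ofHom_eq_ofHom_iff φ ψ).1 h
  intro x y hxy
  apply hφ
  have h1 : c * φ x * c⁻¹ = c * φ y * c⁻¹ := by rw [← hc x, ← hc y, hxy]
  exact mul_left_cancel (mul_right_cancel h1)

/-- An outer ISOMORPHISM has injective representatives (`g ∘ f ~ id` up to an inner automorphism). ([IUTchI] §0 p.34) [claim: Mochizuki2012, status: disputed] -/
theorem injective_of_isOuterIso (φ : H →* H') (h : (ofHom φ).IsOuterIso) : Function.Injective φ := by
  obtain ⟨g, hfg, -⟩ := h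
  obtain ⟨ψ, rfl⟩ := ofHom_surjective g
  rw [comp_ofHom, id] at hfg
  obtain ⟨c, hc⟩ := (ofHom_eq_ofHom_iff _ _).1 hfg
  intro x y hxy
  have hx := hc x
  have hy := hc y
  simp only [MonoidHom.id_apply, MonoidHom.comp_apply] at hx hy
  rw [hx, hy, hxy]

/-- The outer class of a morphism of the orbit category has ONLY injective representatives (abc-iut-L5-t3's `exists_injective_rep_toOuter` +
class invariance). ([IUTchI] §0 p.34) [claim: Mochizuki2012, status: disputed] -/
theorem injective_of_ofHom_eq_toOuter (f : (OrbitCat.of H : OrbitCat A) ⟶ OrbitCat.of H') {ψ : H →* H'}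
    (h : ofHom ψ = OrbitCat.toOuter f) : Function.Injective ψ := by
  obtain ⟨φ, hφ, hinj⟩ := OrbitCat.exists_injective_rep_toOuter f
  exact injective_of_ofHom_eq (hφ.trans h.symm) hinj

end OuterHom

/-! ### The printed class `φ^Θ_{v̲_j}`: non-injective, non-invertible, disjoint from the coset maps -/

section EvalSectionsNotCoset

variable {F : Type u} {K : Type v} {Fbar : Type w} [Field F] [NumberField F] [Field K] [NumberField K]
  [Algebra F K] [Field Fbar] [Algebra F Fbar] [Algebra K Fbar]
  {E : WeierstrassCurve F} [E.IsElliptic] {l : ℕ} {Pb : BadPlacePredicates K}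
  {D : InitialThetaData F K Fbar E l Pb} {CG : D.geom.pe.CuspGalois} {hS : D.CuspClassesNormaliserStable} [Fact l.Prime]

namespace InitialThetaData.EvalSections

variable {δ : D.LocalDatum CG hS} {Gv : Subgroup (Fbar ≃ₐ[F] Fbar)} (ES : EvalSections δ Gv)

/-- **`s_j ∘ aug|_{Π_v̲}` is NOT injective** once `Π_v̲` meets `Ker(aug)` non-trivially (it kills `Π_v̲ ∩ Δ`: `evalHom_eq_one_of_aug_eq_one`).
([IUTchI] Ex 4.4 (i)(ii) p.107) [claim: Mochizuki2012, status: disputed] -/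
theorem not_injective_evalHom (hΔ : ∃ x : ↥δ.H, D.augGF x = 1 ∧ x ≠ 1) (j : FlAbs l) :
    ¬ Function.Injective (ES.evalHom j) := by
  obtain ⟨x, hx, hx1⟩ := hΔ
  intro hinj
  exact hx1 (hinj ((ES.evalHom_eq_one_of_aug_eq_one j hx).trans (map_one _).symm))

/-- No representative of the outer class `φ^Θ_{v̲_j}` is injective. ([IUTchI] Ex 4.4 (i)(ii) p.107) [claim: Mochizuki2012, status: disputed] -/
theorem not_injective_of_ofHom_eq_evalOuter (hΔ : ∃ x : ↥δ.H, D.augGF x = 1 ∧ x ≠ 1) (j : FlAbs l) {ψ : ↥δ.H →* ↥δ.H}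
    (h : OuterHom.ofHom ψ = ES.evalOuter j) : ¬ Function.Injective ψ := fun hψ =>
  ES.not_injective_evalHom hΔ j (OuterHom.injective_of_ofHom_eq h hψ)

/-- **`φ^Θ_{v̲_j}` is NOT an outer isomorphism** — the outer hom-type at a bad place HAS non-invertible endomorphisms of `𝒟_v̲`, as the §4 typing
requires (`BaseThetaDatum.exists_endo_not_isIso`, p456090). ([IUTchI] Ex 4.4 (i)(ii) p.107) [claim: Mochizuki2012, status: disputed] -/
theorem not_isOuterIso_evalOuter (hΔ : ∃ x : ↥δ.H, D.augGF x = 1 ∧ x ≠ 1) (j : FlAbs l) : ¬ (ES.evalOuter j).IsOuterIso := fun h =>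
  ES.not_injective_evalHom hΔ j (OuterHom.injective_of_isOuterIso _ h)

/-- **J-Θ-1 in kernel form: `φ^Θ_{v̲_j}` is the outer class of NO morphism of the orbit category** (those have injective representatives).
([IUTchI] Ex 4.4 (i)(ii) p.107) [claim: Mochizuki2012, status: disputed] -/
theorem toOuter_ne_evalOuter (hΔ : ∃ x : ↥δ.H, D.augGF x = 1 ∧ x ≠ 1) (j : FlAbs l)
    (f : (OrbitCat.of δ.H : OrbitCat D.PiC) ⟶ OrbitCat.of δ.H) : OrbitCat.toOuter f ≠ ES.evalOuter j := fun h =>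
  ES.not_injective_evalHom hΔ j (OuterHom.injective_of_ofHom_eq_toOuter f h.symm)

/-- A member `α ≫ φ^Θ_{v̲_j} ≫ β` of the saturated class is the class of `c_m ∘ (s_j ∘ aug) ∘ c_n`, which kills `n⁻¹(Π_v̲ ∩ Δ)n ∋ n x n⁻¹`-preimages:
NO representative of it is injective. ([IUTchI] Ex 4.4 (ii) p.107) [claim: Mochizuki2012, status: disputed] -/
theorem not_injective_of_ofHom_eq_of_mem_thetaClass (hΔ : ∃ x : ↥δ.H, D.augGF x = 1 ∧ x ≠ 1) {j : FlAbs l}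
    {f : OuterHom δ.H δ.H} (hf : f ∈ ES.thetaClass j) {ψ : ↥δ.H →* ↥δ.H} (h : OuterHom.ofHom ψ = f) :
    ¬ Function.Injective ψ := by
  obtain ⟨n, m, hn, hm, rfl⟩ := hf
  obtain ⟨x, hx, hx1⟩ := hΔ
  -- the composite representative
  rw [evalOuter, OuterHom.ofConj, OuterHom.ofConj, OuterHom.comp_ofHom, OuterHom.comp_ofHom] at h
  intro hψ
  have hinj := OuterHom.injective_of_ofHom_eq h hψ
  -- `y := n x n⁻¹ ∈ Π_v̲` is a nontrivial element with `c_n y = x ∈ Ker(aug)`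
  have hnx : (n : D.PiC) * x * n⁻¹ ∈ δ.H := (Subgroup.mem_normalizer_iff.mp hn x).mp x.2
  set y : ↥δ.H := ⟨n * x * n⁻¹, hnx⟩ with hy
  have hcy : OuterHom.conjHom n (conj_mem_of_mem_normalizer hn) y = x := by
    apply Subtype.ext
    rw [OuterHom.coe_conjHom]
    change n⁻¹ * (n * (x : D.PiC) * n⁻¹) * n = x
    group
  have hval : ((OuterHom.conjHom m (conj_mem_of_mem_normalizer hm)).comp
      ((ES.evalHom j).comp (OuterHom.conjHom n (conj_mem_of_mem_normalizer hn)))) y = 1 := by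
    rw [MonoidHom.comp_apply, MonoidHom.comp_apply, hcy, ES.evalHom_eq_one_of_aug_eq_one j hx, map_one]
  have hy1 : y = 1 := hinj (hval.trans (map_one _).symm)
  apply hx1
  have : (n : D.PiC) * x * n⁻¹ = 1 := congrArg Subtype.val hy1
  apply Subtype.ext
  change (x : D.PiC) = 1
  have h2 : (x : D.PiC) = n⁻¹ * (n * x * n⁻¹) * n := by group
  rw [h2, this]; group

/-- **No member of the class `φ^Θ_{v̲_j}` is an outer isomorphism.** ([IUTchI] Ex 4.4 (ii) p.107) [claim: Mochizuki2012, status: disputed] -/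
theorem not_isOuterIso_of_mem_thetaClass (hΔ : ∃ x : ↥δ.H, D.augGF x = 1 ∧ x ≠ 1) {j : FlAbs l} {f : OuterHom δ.H δ.H}
    (hf : f ∈ ES.thetaClass j) : ¬ f.IsOuterIso := by
  obtain ⟨ψ, rfl⟩ := OuterHom.ofHom_surjective f
  exact fun h => ES.not_injective_of_ofHom_eq_of_mem_thetaClass hΔ hf rfl (OuterHom.injective_of_isOuterIso ψ h)

/-- **The whole class `φ^Θ_{v̲_j}` is DISJOINT from the image of the orbit category** (`OrbitCat.toOuter`): print's bad-place Θ-bridge constituents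
are not coset maps. ([IUTchI] Ex 4.4 (ii) p.107) [claim: Mochizuki2012, status: disputed] -/
theorem toOuter_ne_of_mem_thetaClass (hΔ : ∃ x : ↥δ.H, D.augGF x = 1 ∧ x ≠ 1) {j : FlAbs l} {f : OuterHom δ.H δ.H}
    (hf : f ∈ ES.thetaClass j) (g : (OrbitCat.of δ.H : OrbitCat D.PiC) ⟶ OrbitCat.of δ.H) : OrbitCat.toOuter g ≠ f := by
  obtain ⟨φ, hφ, hinj⟩ := OrbitCat.exists_injective_rep_toOuter g
  intro h
  exact ES.not_injective_of_ofHom_eq_of_mem_thetaClass hΔ hf (hφ.trans h) hinj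

end InitialThetaData.EvalSections

end EvalSectionsNotCoset

end Literature.IUT.HodgeTheaters
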